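import Summits.QuantumFields.YangMills.Theorems.BalabanUVNodesN12SliceDatumLevelZeroLinear
import Literature.MathematicalPhysics.QuantumFieldTheory.Balaban1983to89.Node00.MultiScaleFibreChartB
import Literature.MathematicalPhysics.QuantumFieldTheory.Balaban1983to89.B15Prop1SliceNondegeneracyFromRealCoerciveTowerB
import HarnessLib

/-!
# BalabanUVNodes ∕ N12 — THE LEVEL-`0` COMPONENTS OF THE SLICE DATUM COORDINATES ARE LINEAR NEAR `0`, SO THE CHART CURVATURE HAS NO `Γ₀` COMPONENT: the letter (R1b) of the — **BOND-DATUM EDITION** (`…N12SliceDatumLevelZeroLinearB`, USED DECLARATIONS ONLY)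

The print-datum ([Balaban1984PropagatorsII] (2.3)) (γ) twin of `Summits/…/Theorems/BalabanUVNodesN12SliceDatumLevelZeroLinear.lean`: the declarations of the parent whose STATEMENT reads the determining datum
(`curvatureData_levelZeroFree`, `fderiv_fderiv_sliceDatum_apply_levelZero`, `sliceDatum_levelZero_eq_near`) and which N12's junction of record v14ᴸ uses (dag-n12-c g35 probe-2 census `UsedConstsN12RoadTyped2`, THEOREMS block), re-typed over a
BOND-LEVEL datum `𝔅 : BDetSet` (F0a `B15DeterminingSetsB`) and dag-n12-c's bond-datum chart `Node00.msChartB` (✓p774329; `msChart 𝐁 = msChartB (bondsDet 𝐁)` by `rfl`).  GENERATOR twin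
(this seat's `work/g32/gen_thm.py`, block-extracted from the parent's tree bytes): namespace `…N12SliceDatumLevelZeroLinearB`, SAME short names, `DetSet ↦ BDetSet`, `AgreeOn 𝐁 ↦ AgreeOnB 𝔅`,
`IsMinimizer ↦ IsMinimizerB`, `bondsOf (𝐁 j) ↦ 𝔅 j`, `msChart ∕ constrCard ∕ constrEnum ∕ ConstrSet ↦ …B`, NODE 00 chart lemmas `…msChart… ↦ …msChartB…`; proofs VERBATIM; the parent's
datum-free declarations REUSED BY NAME (`open`), never copied (private plumbing excepted, №366 R2).  The parent's (b) statements are the instances `𝔅 := bondsDet 𝐁`.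

Cell `pub-ymgap` (HUMAN RULINGS D-0062 ∕ D-0149), seat `pub-ymgap-dag-n12-d` g32 (R134 N12 [B15] s2; the (ii) Theorems-side re-key of N12's road at print's [II] (2.3) datum — director-ym №338 ∕
№343 (E1)(iii-b), FLAG №16 ∕ ruling (α); dag-n12-c DESIGN memo a793b2ebc0b803bf (ii); `N12-ROAD-TWIN-ORDER-2026-08-30.md`).  Count-neutral helper of K1⁹ `stmt-QuantumFields-27364`,
`--kind proof --supports … --as helper`.  THEOREMS ONLY (0 `def`, 0 `instance`, 0 `sorry`).

HONEST FRAMING (director-ym №338 (5)).  PURELY ADDITIVE: the parent stays landed and true on its own text; nothing in it is edited; no displayed premise of any consumer is deleted or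
weakened; every hypothesis of the parent stays a hypothesis.  Nothing of Bałaban's analysis asserted; N12 NOT discharged; K0⁷ ∕ K1⁹ NOT closed; counts unmoved (typed 28∕28 · discharged
8∕27, A 8∕28; K 1∕4); one finite 𝕋⁴ programme at fixed ε — R4 closes the conditional rung `BalabanLadder.UV` only; NOT the Yang–Mills mass gap (Clay); nothing continuum ∕ ℝ⁴ ∕ OS.

PARENT's DOCSTRING (the mathematics and the citations; read the site-level `𝐁` as the bond datum `𝔅`):
# BalabanUVNodes ∕ N12 — THE LEVEL-`0` COMPONENTS OF THE SLICE DATUM COORDINATES ARE LINEAR NEAR `0`, SO THE CHART CURVATURE HAS NO `Γ₀` COMPONENT: the letter (R1b) of the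
# multiplier row (M) («the curvature data `D²Φ₀(0)[p̂,p̂]` vanish at the level-`0` rows») DISCHARGED — in fact `(D²Φ₀(0)[v,w])_{(0,c)} = 0` for ALL directions
# ([Balaban1988Convergent] (2.2) p. 255, (2.10)–(2.11) p. 256 («M⁰ = id»); [Balaban1985Variational] (81)–(83) p. 290; [Balaban1989LargeFieldII] (1.12) p. 359, (1.19) p. 360)

Cell `pub-ymgap` (HUMAN RULINGS D-0062 ∕ D-0149), WIDTH SEAT `pub-ymgap-dag-n12-w6` g14 (node N12 = [B15]; key K1⁹ `stmt-QuantumFields-27364`, `--kind proof --supports … --as helper`;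
count-neutral; bus 2026-08-29 DAGN12W6-G14 CLAIM-3).  THEOREMS ONLY (0 `def`, 0 `instance`, 0 `sorry`).  CONSUMED BY NAME, nothing modified: dag-n12-w1 ∕ dag-n12-w5's holomorphic chart
`B15SU2ChartHolomorphic` (`expMulC`, `expPointC`, `logCoordC_expPointC`, `decomp_genE`, `genE_trace`), `B15AveragingHolomorphic.iterMh_zero`, `T4AdjointCovarianceUnitary.exp_conj_unitary`, the lane owner's
`B15Prop1SliceNondegeneracyFromRealCoerciveTower.analyticAt_sliceDatum_of_guardOn` (g24).  dag-n12-w4's `Node00.fderiv_fderiv_msChart_apply_levelZero` is the same fact for NODE 00's REAL chart `msChart`.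

WHY.  The (M) producer `…N12SlicePreimageLetterOfClass.multiplierLetter_Bj_of_isMinimizer_class` (this seat, file C) displays (R1b): the curvature data `D²Φ₀(0)[p̂,p̂]` of real kernel
directions vanish at the level-`0` rows `(0, c)`, `c ∈ bondsOf Γ₀`.  At such a row the slice datum coordinate is `logCoordC(U₀(c)⋆·exp(Σ_a X_{c,a}E_a)·U₀(c)) = logCoordC(exp(Ad(U₀(c)⋆)(Σ_a X_{c,a}E_a)))`
(`M⁰ = id`, `W_0(c) = U₀(c)` on the fibre), i.e. the coordinates of `Ad(U₀(c)⋆)(Σ_a X_{c,a}E_a)` as long as that matrix is `log 2`-small — a continuous LINEAR function of `X` on a neighbourhood of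
`0`.  So the derivative of that component is locally constant and its second derivative vanishes, in every pair of directions.

CONTENTS (namespace `Summit.QuantumFields.YangMills.BalabanUVNodes.N12SliceDatumLevelZeroLinear`).
* §1 `fderiv_fderiv_apply_pi'`, `fderiv_fderiv_eq_zero_of_eventuallyEq_clm` (calculus over any `RCLike` field: components of second derivatives; a map agreeing with a continuous linear map near
  `x₀` has vanishing second derivative there).
* §2 `exists_adCoordsCLM` (`g⋆(Σ_a z_aE_a)g = Σ_a (R z)_aE_a` for a continuous linear `R`, `g ∈ SU(2)`), `sliceDatum_levelZero_eq_near` (the level-`0` component IS `R ∘ eval_c` near `0`).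
* §3 ★★★ `fderiv_fderiv_sliceDatum_apply_levelZero` (`(D²Φ₀(0)[v,w])_{(0,c)} = 0` under the per-tower guards and the fibre condition), ★★ `curvatureData_levelZeroFree` (the (R1b) row VERBATIM).

HONEST FRAMING.  Matrix algebra + elementary calculus; nothing of Bałaban's asserted; N12 NOT discharged; K1⁹ NOT closed; counts of record unmoved (typed 28∕28 · discharged 8∕27); one finite 𝕋⁴
programme at fixed ε — R4 closes the conditional rung `BalabanLadder.UV` only; no summit statement is proved here and NOT the Yang–Mills mass gap (Clay); nothing continuum ∕ ℝ⁴ ∕ OS.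
-/

noncomputable section

namespace Summit.QuantumFields.YangMills.BalabanUVNodes.N12SliceDatumLevelZeroLinearB

open Literature.MathematicalPhysics.QuantumFieldTheory.Balaban1983to89.B15DeterminingSetsB

open Set Metric Filter
open scoped Topology BigOperators Matrix.Norms.L2Operator
open Literature.MathematicalPhysics.QuantumFieldTheory.Balaban1983to89
open Literature.MathematicalPhysics.QuantumFieldTheory.Balaban1983to89.Node00 (SU coeField coeField_apply SmallBelow ConstrSetB constrCardB constrEnumB star_coe_mul_coe_SU coe_mul_star_coe_SU coe_inv_SU)
open T4AdjointCovarianceUnitary (lieSU exp_conj_unitary toUnitary coe_toUnitary)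
open B15AveragingHolomorphic (iterMh iterMh_zero)
open B15SU2ChartHolomorphic (genE expMulC expPointC logCoordC logCoordC_expPointC decomp_genE genE_trace)
open B15Prop1SliceNondegeneracyFromRealCoerciveTowerB (analyticAt_sliceDatum_of_guardOn)
open B15Prop1AnalyticExtClause (cplxVec)
open B15Prop1ChartCalculusSU2 (E3)
open B15Prop1ChartSU2 (su2Chart)
open ExpMeanLog (expMeanLogSU)
open BlockAveraging (blockAvg)
open T4CubeChartGnomonic (SU2)
open T4Continuum B15DeterminingSets GaugeField
open Summit.QuantumFields.YangMills.BalabanUVNodes.N12SliceDatumLevelZeroLinear (exists_adCoordsCLM fderiv_fderiv_apply_pi' fderiv_fderiv_eq_zero_of_eventuallyEq_clm star_mul_exp_mul_eq)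

section
variable {P : Params}
variable (𝔅 : BDetSet P) (k : ℕ) (W : MSField P SU2) {U₀ : GaugeField P 0 SU2}
  (hU₀ : AgreeOnB 𝔅 (avgFamily (fun j => blockAvg (P := P) (j := j) expMeanLogSU) U₀) W)
  (S : Submodule ℂ (VecField P 0 (EuclideanSpace ℂ (Fin 3))))
  {Φ₀ : S → Fin (constrCardB 𝔅 k) → EuclideanSpace ℂ (Fin 3)}
  (hΦ₀ : ∀ (X : S) i, Φ₀ X i = logCoordC (star ((W ((constrEnumB 𝔅 k).symm i).1 ((constrEnumB 𝔅 k).symm i).2.1 : SU2) : Matrix (Fin 2) (Fin 2) ℂ) *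
    iterMh ((constrEnumB 𝔅 k).symm i).1 (expMulC (X : VecField P 0 (EuclideanSpace ℂ (Fin 3))) (coeField U₀)) ((constrEnumB 𝔅 k).symm i).2.1))
include hU₀ hΦ₀

/-- ★ **THE LEVEL-`0` COMPONENT OF THE SLICE DATUM COORDINATES IS LINEAR NEAR `0`**: for `c ∈ bondsOf (𝐁 0)` there is a continuous ℂ-linear `L : S → ℂ³` with `Φ₀ X (0,c) = L X` for all
`X` near `0` — `Φ₀ X (0,c) = logCoordC(U₀(c)⋆·exp(Σ_a X_{c,a}E_a)·U₀(c)) = logCoordC(exp(Σ_a (R X_c)_aE_a)) = R X_c` while `‖Σ_a (R X_c)_aE_a‖ < log 2` (`M⁰ = id`, `W_0(c) = U₀(c)`).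
[cite: Balaban1988Convergent, (2.2) p.255, (2.10)–(2.11) p.256; Balaban1989LargeFieldII, (1.19) p.360; Balaban1985Averaging, (21) p.21] -/
theorem sliceDatum_levelZero_eq_near (c : PBond P 0) (hc : c ∈ (𝔅 0)) :
    ∃ L : S →L[ℂ] EuclideanSpace ℂ (Fin 3), ∀ᶠ X in 𝓝 (0 : S), Φ₀ X (constrEnumB 𝔅 k ⟨⟨0, Nat.succ_pos k⟩, c, hc⟩) = L X := by
  obtain ⟨R, hR⟩ := exists_adCoordsCLM (U₀ c)
  -- the linear model `X ↦ R (X c)`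
  let ev : S →L[ℂ] EuclideanSpace ℂ (Fin 3) := (ContinuousLinearMap.proj (R := ℂ) c).comp S.subtypeL
  refine ⟨R.comp ev, ?_⟩
  -- the smallness set `‖Σ_a (R (X c))_a E_a‖ < log 2` is a neighbourhood of `0`
  have hcont : Continuous fun X : S => ∑ a : Fin 3, (R (ev X)) a • genE a := by
    refine continuous_finsetSum _ fun a _ => ?_
    exact ((PiLp.continuous_apply 2 (fun _ : Fin 3 => ℂ) a).comp ((R.comp ev).continuous)).smul continuous_const
  have h0 : ‖∑ a : Fin 3, (R (ev (0 : S))) a • genE a‖ < Real.log 2 := by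
    have : ev (0 : S) = 0 := map_zero ev
    rw [this, map_zero]
    simp only [PiLp.zero_apply, zero_smul, Finset.sum_const_zero, norm_zero]
    exact Real.log_pos (by norm_num)
  have hnear : ∀ᶠ X in 𝓝 (0 : S), ‖∑ a : Fin 3, (R (ev X)) a • genE a‖ < Real.log 2 :=
    (hcont.norm.continuousAt (x := (0 : S))).eventually_lt continuousAt_const h0
  filter_upwards [hnear] with X hX
  have hW0 : W 0 c = U₀ c := by
    have h := hU₀ 0 c hc
    exact h.symm
  have hidx : (constrEnumB 𝔅 k).symm (constrEnumB 𝔅 k ⟨⟨0, Nat.succ_pos k⟩, c, hc⟩) = ⟨⟨0, Nat.succ_pos k⟩, c, hc⟩ := (constrEnumB 𝔅 k).symm_apply_apply _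
  rw [hΦ₀, hidx]
  show logCoordC (star ((W 0 c : SU2) : Matrix (Fin 2) (Fin 2) ℂ) * iterMh 0 (expMulC (X : VecField P 0 (EuclideanSpace ℂ (Fin 3))) (coeField U₀)) c) = R (ev X)
  rw [iterMh_zero, hW0]
  show logCoordC (star ((U₀ c : SU2) : Matrix (Fin 2) (Fin 2) ℂ) * (expPointC ((X : VecField P 0 (EuclideanSpace ℂ (Fin 3))) c) * ((U₀ c : SU2) : Matrix (Fin 2) (Fin 2) ℂ))) = R (ev X)
  rw [← mul_assoc, expPointC, star_mul_exp_mul_eq, hR]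
  have hev : (X : VecField P 0 (EuclideanSpace ℂ (Fin 3))) c = ev X := rfl
  rw [hev]
  exact logCoordC_expPointC _ hX

end

section
variable {P : Params}

/-- ★★★ **NO CHART CURVATURE ON THE `Γ₀` LAYER (slice datum coordinates)**: under the per-tower guards of `U₀` on the fibre of `W` (so `Φ₀` is analytic at `0`, the lane owner's
`analyticAt_sliceDatum_of_guardOn`), for every `c ∈ bondsOf (𝐁 0)` and all directions `v w : S`, `(D²Φ₀(0)[v,w])_{(0,c)} = 0` — the component is linear near `0` (§2).
[cite: Balaban1988Convergent, (2.2) p.255, (2.10)–(2.11) p.256; Balaban1985Variational, (81)–(83) p.290; Balaban1989LargeFieldII, (1.12) p.359] -/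
theorem fderiv_fderiv_sliceDatum_apply_levelZero (𝔅 : BDetSet P) (k : ℕ) (hk : k ≤ P.m + P.K) (W : MSField P SU2) {U₀ : GaugeField P 0 SU2}
    (hgU : ∀ i : Fin (constrCardB 𝔅 k), ∀ j', j' < (((constrEnumB 𝔅 k).symm i).1 : ℕ) → ∀ c' : PBond P (j' + 1),
      c' ∈ B10Eq42TorusConstraint.bondsIn (j' + 1) (B14.Eq22Determines.blockIter (((constrEnumB 𝔅 k).symm i).1 : ℕ) ⁻¹'
        ({((constrEnumB 𝔅 k).symm i).2.1.src, ((constrEnumB 𝔅 k).symm i).2.1.tgt} : Set (Site P ((constrEnumB 𝔅 k).symm i).1))) →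
        BlockAveraging.Small expMeanLogSU (Averaging.iter (fun j => blockAvg (P := P) (j := j) expMeanLogSU) j' U₀) c')
    (hU₀ : AgreeOnB 𝔅 (avgFamily (fun j => blockAvg (P := P) (j := j) expMeanLogSU) U₀) W)
    (S : Submodule ℂ (VecField P 0 (EuclideanSpace ℂ (Fin 3))))
    {Φ₀ : S → Fin (constrCardB 𝔅 k) → EuclideanSpace ℂ (Fin 3)}
    (hΦ₀ : ∀ (X : S) i, Φ₀ X i = logCoordC (star ((W ((constrEnumB 𝔅 k).symm i).1 ((constrEnumB 𝔅 k).symm i).2.1 : SU2) : Matrix (Fin 2) (Fin 2) ℂ) *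
      iterMh ((constrEnumB 𝔅 k).symm i).1 (expMulC (X : VecField P 0 (EuclideanSpace ℂ (Fin 3))) (coeField U₀)) ((constrEnumB 𝔅 k).symm i).2.1))
    (c : PBond P 0) (hc : c ∈ (𝔅 0)) (v w : S) :
    fderiv ℂ (fderiv ℂ Φ₀) 0 v w (constrEnumB 𝔅 k ⟨⟨0, Nat.succ_pos k⟩, c, hc⟩) = 0 := by
  have han : AnalyticAt ℂ Φ₀ 0 := analyticAt_sliceDatum_of_guardOn S 𝔅 k hk W hgU hU₀ hΦ₀
  have hcd : ContDiffAt ℂ 2 Φ₀ 0 := han.contDiffAt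
  have hd : ∀ᶠ X in 𝓝 (0 : S), DifferentiableAt ℂ Φ₀ X := by
    have h := hcd.eventually (by simp)
    filter_upwards [h] with X hX
    exact hX.differentiableAt (by simp)
  have hd2 : DifferentiableAt ℂ (fderiv ℂ Φ₀) 0 := by
    have h := hcd.fderiv_right (m := 1) (by norm_num)
    exact h.differentiableAt (by simp)
  obtain ⟨L, hL⟩ := sliceDatum_levelZero_eq_near 𝔅 k W hU₀ S hΦ₀ c hc
  rw [fderiv_fderiv_apply_pi' hd hd2, fderiv_fderiv_eq_zero_of_eventuallyEq_clm hL]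
  rfl

end

section
variable {P : Params}

/-- ★★ **THE (R1b) ROW DISCHARGED**: the curvature data of real kernel directions vanish at the level-`0` rows — the hypothesis `hAdm` of this seat's
`…N12SlicePreimageLetterOfClass.multiplierLetter_Bj_of_isMinimizer_class` VERBATIM (indeed for every real slice direction, kernel or not).
[cite: Balaban1988Convergent, (2.2) p.255, (2.10)–(2.11) p.256; Balaban1985Variational, (81)–(83) p.290; Balaban1989LargeFieldII, (1.12) p.359] -/
theorem curvatureData_levelZeroFree (𝔅 : BDetSet P) (k : ℕ) (hk : k ≤ P.m + P.K) (W : MSField P SU2) {U₀ : GaugeField P 0 SU2}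
    (hgU : ∀ i : Fin (constrCardB 𝔅 k), ∀ j', j' < (((constrEnumB 𝔅 k).symm i).1 : ℕ) → ∀ c' : PBond P (j' + 1),
      c' ∈ B10Eq42TorusConstraint.bondsIn (j' + 1) (B14.Eq22Determines.blockIter (((constrEnumB 𝔅 k).symm i).1 : ℕ) ⁻¹'
        ({((constrEnumB 𝔅 k).symm i).2.1.src, ((constrEnumB 𝔅 k).symm i).2.1.tgt} : Set (Site P ((constrEnumB 𝔅 k).symm i).1))) →
        BlockAveraging.Small expMeanLogSU (Averaging.iter (fun j => blockAvg (P := P) (j := j) expMeanLogSU) j' U₀) c')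
    (hU₀ : AgreeOnB 𝔅 (avgFamily (fun j => blockAvg (P := P) (j := j) expMeanLogSU) U₀) W)
    (S : Submodule ℂ (VecField P 0 (EuclideanSpace ℂ (Fin 3))))
    {Φ₀ : S → Fin (constrCardB 𝔅 k) → EuclideanSpace ℂ (Fin 3)}
    (hΦ₀ : ∀ (X : S) i, Φ₀ X i = logCoordC (star ((W ((constrEnumB 𝔅 k).symm i).1 ((constrEnumB 𝔅 k).symm i).2.1 : SU2) : Matrix (Fin 2) (Fin 2) ℂ) *
      iterMh ((constrEnumB 𝔅 k).symm i).1 (expMulC (X : VecField P 0 (EuclideanSpace ℂ (Fin 3))) (coeField U₀)) ((constrEnumB 𝔅 k).symm i).2.1)) :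
    ∀ (p : VecField P 0 E3) (hp : cplxVec p ∈ S), fderiv ℂ Φ₀ 0 ⟨cplxVec p, hp⟩ = 0 →
      ∀ (b : PBond P 0) (hb : b ∈ (𝔅 0)),
        fderiv ℂ (fderiv ℂ Φ₀) 0 ⟨cplxVec p, hp⟩ ⟨cplxVec p, hp⟩ (constrEnumB 𝔅 k ⟨⟨0, Nat.succ_pos k⟩, b, hb⟩) = 0 :=
  fun _ _ _ b hb => fderiv_fderiv_sliceDatum_apply_levelZero 𝔅 k hk W hgU hU₀ S hΦ₀ b hb _ _

end

end Summit.QuantumFields.YangMills.BalabanUVNodes.N12SliceDatumLevelZeroLinearB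

end
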